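import Summits.ABC.StewartYu.PadicMulticubicLiouville
import Literature.NumberTheory.Transcendental.PadicLiouvilleInequality
import HarnessLib

/-!
# Cell abc-stewartyu, WP-Y2 / `TwoAdicPrincipalCubic`: the third-point Liouville inequality in `ℚ_p`

`Summits/ABC/StewartYu/PadicMulticubicLiouvillePadic.lean` — cell `abc-stewartyu` (lit seat g3;
one theorem, no definition, no named fact), sequel to `PadicMulticubicLiouville.lean`: the `ℚ_p`
instance of `MulticubLiouville.norm_ev3_ge` (the two hypotheses `‖z‖_p ≤ 1`, `‖n‖_p ≥ 1/n` are
`Padic.norm_int_le_one` and the tree's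
`Literature.NumberTheory.Transcendental.inv_natCast_le_norm_natCast`). For the `2`-adic engine the
cube roots `tⱼ ∈ ℤ₂` of the generators `qⱼ² ≡ 1 (mod 8)`
(`Literature.NumberTheory.LocalFields.padicInt_two_exists_cube_eq`) are used through the coercion
`ℤ₂ → ℚ₂`. [folklore]
-/

noncomputable section

open Finset

namespace Summit.ABC.StewartYu

namespace MulticubLiouville

open Multicub

/-- **The multicubic Liouville inequality in `ℚ_p`:** for integer generators `αⱼ` with the
`3`-Kummer condition, cube roots `tⱼ ∈ ℚ_p` (`tⱼ³ = αⱼ`, `‖tⱼ‖ ≤ 1`), and a non-zero coefficient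
vector `c` with `D c ∈ ℤ`, `∑ |c| ≤ M` (`D, M ≥ 1`):
`‖ev3 t c‖_p ≥ 1/(6 D M ∏ⱼ max(1,|αⱼ|))^{3^{k+1} − 1}`. [folklore] -/
theorem norm_ev3_ge_padic {p : ℕ} [Fact p.Prime] (k : ℕ) (α : Fin k → ℚ)
    (hα : ∀ j, ∃ a : ℤ, α j = a)
    (hind : ∀ κ : Fin k → ℕ, (∃ j, ¬ 3 ∣ κ j) → ∀ γ : ℚ, ∏ j, α j ^ κ j ≠ γ ^ 3)
    (t : Fin k → ℚ_[p]) (ht : ∀ j, t j ^ 3 = (α j : ℚ_[p])) (ht1 : ∀ j, ‖t j‖ ≤ 1)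
    (c : (Fin k → Fin 3) → ℚ) (hc : c ≠ 0) (D : ℕ) (hD : 1 ≤ D)
    (hden : ∀ l, ∃ z : ℤ, (D : ℚ) * c l = z) (M : ℝ) (hM : 1 ≤ M)
    (hcM : ∑ l, |(c l : ℝ)| ≤ M) :
    1 / (6 * (D : ℝ) * M * ∏ j, max 1 |(α j : ℝ)|) ^ (3 ^ (k + 1) - 1) ≤ ‖ev3 t c‖ :=
  norm_ev3_ge (fun z => Padic.norm_int_le_one z)
    (fun _ hn => Literature.NumberTheory.Transcendental.inv_natCast_le_norm_natCast hn)
    k α hα hind t ht ht1 c hc D hD hden M hM hcM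

end MulticubLiouville

end Summit.ABC.StewartYu

end
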